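import Summits.QuantumFields.BalabanUV.T4Continuum.Support.SubstrateTransporterSpeciesLev
import Summits.QuantumFields.BalabanUV.T4Continuum.Support.CovariantVectorCoerciveHoloForm

/-!
# SUBSTRATE — [dict] D-8 AT LEVEL LETTERS, EXPLICIT RADIUS (typer NEXT gen 7.1 W-2): the Lev trio of `SubstrateTransporterSpeciesLev`
# (ball ⊆ `regularSetLev`, `‖greenT_k‖` bound, analyticity of `covAtTLev` on the ball) on p3's FORM-RELATIVE radius in Bałaban's SCALING FORM —
# ONE explicit tower radius `rhoLev = rhoStar(γ, d, a′, |o|) / L^K`, level- and background-free prefactor, `‖greenT_k‖ ≤ 4/γ` at every level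

Cell `pub-balaban`, SUBSTRATE cell, seat `b2b-balaban-substrate-p1` (gen 3).  Summits-side under the LEAN PLACEMENT RULE.  Composition BY NAME of
`SubstrateTransporterSpeciesLev` (p223342: `regularSetLev`, `covAtTLev`, `analyticOnNhd_covAtTLev_expChart`, `coercive_vecOp_towerDataOf_of_regular`)
with p3's `CovariantVectorCoerciveHoloForm` (p223486: `rhoStar γ d a′ co` LEVEL-FREE, `inHoloBallT_rhoStar_subset_regularSetAt`,
`holoRadiusCompat_rhoStar`).

NAMING RULE (typer gen 7.1): TWO `rhoStar`s exist — `SubstrateTransporterSpeciesLev.rhoStar` (by-continuity, `min` over levels of p3's CHOICE radii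
`holoRadius_k`; TYPE wiring) and `CovariantVectorCoerciveHoloForm.rhoStar γ d a′ co` (EXPLICIT, level-free; the per-level radius is
`rhoStar/lev k`).  This file never `open`s both: `SubstrateTransporterSpeciesLev` is opened for its sets and species, and p3's radius is written
QUALIFIED as `CovariantVectorCoerciveHoloForm.rhoStar`; the tower radius defined here is called `rhoLev`.

HONEST FRAMING: rung (B)+1 of the FINITE-VOLUME T⁴ programme — NOT infinite volume, NOT a mass gap, NOT Clay; spine PROVED 0∕9; NE4 ∕ NE9 NOT
proved.  BOOKKEEPING ONLY (0 analysis here: the form-relative count is p3's, the analyticity p1's p221513; this file divides by the top level and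
composes); the level-free SMALLNESS `α₁ ≤ rhoStar` of NE9's S-class display is NOT adjudicated (p3's rider, kept).  Nothing printed is asserted
([Balaban1985BackgroundPropagators] Sect. B, [Balaban1987RG1] (1.18) KIND only).  HONEST DEPENDENCY (cell line, verbatim): continuum YM on T⁴ ⇐
BetaPertH ∧ nine spine estimates (0/9 proved); BetaPertH ⇐ (D1) ∧ (D4) ∧ CAP+tail; G-an2-4 gates asym, D1 and NE2/3/4.

WHAT.
* §1 `rhoLev P γ a′ := CovariantVectorCoerciveHoloForm.rhoStar γ P.d a′ (card o) / lev P.L P.K` (`rhoLev_pos`), `lev_le_lev` (levels increase),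
  **`rhoLev_le_div`** (`rhoLev ≤ rhoStar/lev k` for every `k ≤ K`), `holoRadiusCompat_rhoLev` (+ `_rho1`: compatible with p3's per-level `rho1`).
* §2 for a unitary reference tower, `γ`-coercive at every level (ONE level-free `γ`, `0 ≤ a′`) and contours of length `ℓ_k ≤ (d+1)·lev k`:
  **`mem_regularSetAt_of_norm_lt_rhoLev`** (regular AND `‖greenT_k‖ ≤ 4/γ`, p3 BY NAME), **`ball_rhoLev_subset_regularSetLev`**,
  **`opNorm_greenT_le_on_ballExplicit`**, `zero_mem_regularSetLev_printed_explicit`, **`analyticOnNhd_covAtTLev_printed_on_ballExplicit`**,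
  `exists_ball_analyticOnNhd_covAtTLev_printed_explicit` (the `∃ ρ` WITNESSED by `rhoLev`).
* §3 the STANDARD contour system `stdContours P k := contour (lev P.L k) (unitMod P)` meets the length hypothesis (`length_stdContours_le`,
  `stdLen`), so every §2 statement holds for it with NO length binder (`ball_rhoLev_subset_regularSetLev_std`, `analyticOnNhd_covAtTLev_printed_on_ballExplicit_std`).
* §4 the tower OF RECORD `towerDataOf P ι av U` (unitary `ι`, `‖ι g − 1‖ = dist1 g`, small-field letters `α`, `τ` at every level, `0 < a′`,
  `0 < gammaV`): the radius is `rhoLev P (gammaV (card o) d a′ α τ) a′` — BACKGROUND-FREE — and **`ball_rhoLev_subset_regularSetLev_towerDataOf`**,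
  **`analyticOnNhd_covAtTLev_printed_towerDataOf_explicit`**, `opNorm_greenT_le_on_ballExplicit_towerDataOf` hold with only those letters displayed.
* §5 (v1.1, APPEND-ONLY; located remark R-ne9leaf08g15-1): the per-level CYLINDERS `levelBall P k ρ := {A | ‖A k‖ < ρ}` (open; ⊇ the tower ball), and at the
  PER-LEVEL radius `rhoStar∕lev k`: **`mem_regularSetAt_of_mem_levelBall`** (regular ∧ `‖greenT_k‖ ≤ 4∕γ`, no condition at other levels) and
  **`analyticOnNhd_covAtTLev_printed_on_levelBall`** (the level-`k` entries analytic on the whole cylinder) — the level-UNIFORM slot (one inverse power of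
  `lev k`, not of `L^K`); `ball_rhoLev_subset_levelBall` ties it to §2.
-/

noncomputable section

open scoped BigOperators ComplexConjugate Matrix Matrix.Norms.L2Operator Kronecker ComplexOrder

namespace Summit.QuantumFields.BalabanUV.T4Continuum.SubstrateTransporterSpeciesLevExplicit

open Literature.MathematicalPhysics.QuantumFieldTheory.Balaban1983to89
open Literature.MathematicalPhysics.QuantumFieldTheory.Balaban1983to89.B5Prop11Plancherel (Tor fine)
open Literature.MathematicalPhysics.QuantumFieldTheory.Balaban1983to89.B5G183RateUnitTower (lev lev_neZero)
open Summit.QuantumFields.BalabanUV.T4Continuum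
open Summit.QuantumFields.BalabanUV.T4Continuum.CoerciveInverseTower (Coercive)
open Summit.QuantumFields.BalabanUV.T4Continuum.CovariantVectorCoercive (vecOp gammaV)
open Summit.QuantumFields.BalabanUV.T4Continuum.CovariantVectorCoerciveHolo (InHoloBallT HoloRadiusCompat inHoloBallT_iff)
open Summit.QuantumFields.BalabanUV.T4Continuum.CovariantVectorCoerciveHoloForm (rho1 inHoloBallT_rhoStar_subset_regularSetAt
  holoRadiusCompat_rhoStar)
open Summit.QuantumFields.BalabanUV.T4Continuum.SubstrateBackgroundTransporters (transV siteIdx unitMod transV_mem_unitaryGroup)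
open Summit.QuantumFields.BalabanUV.T4Continuum.SubstrateTransporterSpecies
open Summit.QuantumFields.BalabanUV.T4Continuum.SubstrateTransporterSpeciesHolo (expChartT expChartInvT regularSetAt)
open Summit.QuantumFields.BalabanUV.T4Continuum.SubstrateTransporterSpeciesLev (regularSetLev mem_regularSetLev_iff cPr aPr covAtTLev
  analyticOnNhd_covAtTLev_expChart coercive_vecOp_towerDataOf_of_regular)
open Summit.QuantumFields.BalabanUV.T4Continuum.CovariantBlockAveraging (ContourSystem transport contour length_contour_le)

variable (P : Params) {o : Type*} [Fintype o] [DecidableEq o] [Nonempty o]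
variable (Γ : (k : ℕ) → ContourSystem P.d (lev P.L k) (unitMod P))

/-! ## §1 The explicit tower radius -/

omit [Fintype o] [DecidableEq o] [Nonempty o] in
/-- [folklore] The levels increase: `lev L j ≤ lev L k` for `j ≤ k` when `1 ≤ L`. -/
theorem lev_le_lev {L : ℕ} (hL : 1 ≤ L) {j k : ℕ} (h : j ≤ k) : lev L j ≤ lev L k := by
  induction h with
  | refl => exact le_rfl
  | step _ ih => exact ih.trans (Nat.le_mul_of_pos_left _ hL)

/-- [folklore] **THE EXPLICIT TOWER RADIUS** `rhoLev P γ a′ := rhoStar(γ, d, a′, |o|) / L^K`: p3's level-free prefactor over the TOP level — ONE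
radius serving every level `k ≤ K` of the tower chart (the per-level radii are `rhoStar/lev k ≥ rhoLev`). -/
def rhoLev (γ a' : ℝ) : ℝ := CovariantVectorCoerciveHoloForm.rhoStar γ P.d a' (Fintype.card o) / (lev P.L P.K : ℕ)

variable {a' γ : ℝ}

omit [DecidableEq o] [Nonempty o] in
/-- [folklore] `0 < rhoLev`. -/
theorem rhoLev_pos (ha' : 0 ≤ a') (hγ : 0 < γ) : 0 < rhoLev P (o := o) γ a' :=
  div_pos (CovariantVectorCoerciveHoloForm.rhoStar_pos (d := P.d) ha' hγ _) (Nat.cast_pos.2 (Nat.pos_of_ne_zero (NeZero.ne _)))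

omit [DecidableEq o] [Nonempty o] in
/-- [folklore] **`rhoLev ≤ rhoStar/lev k`** at every level `k ≤ K` (levels increase, `1 < L`). -/
theorem rhoLev_le_div (ha' : 0 ≤ a') (hγ : 0 < γ) (k : Fin (P.K + 1)) :
    rhoLev P (o := o) γ a' ≤ CovariantVectorCoerciveHoloForm.rhoStar γ P.d a' (Fintype.card o) / (lev P.L k : ℕ) :=
  div_le_div_of_nonneg_left (CovariantVectorCoerciveHoloForm.rhoStar_pos (d := P.d) ha' hγ _).le
    (Nat.cast_pos.2 (Nat.pos_of_ne_zero (NeZero.ne _)))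
    (Nat.cast_le.2 (lev_le_lev P.L_pos (Nat.le_of_lt_succ k.2)))

omit [DecidableEq o] [Nonempty o] in
/-- [folklore] The constant tower radius is `HoloRadiusCompat` with p3's per-level scaling radii `k ↦ rhoStar/lev k`. -/
theorem holoRadiusCompat_rhoLev (ha' : 0 ≤ a') (hγ : 0 < γ) :
    HoloRadiusCompat (fun _ : Fin (P.K + 1) => rhoLev P (o := o) γ a')
      (fun k => CovariantVectorCoerciveHoloForm.rhoStar γ P.d a' (Fintype.card o) / (lev P.L k : ℕ)) :=
  fun k => rhoLev_le_div P ha' hγ k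

omit [DecidableEq o] [Nonempty o] in
/-- [folklore] … hence with p3's form-relative per-level radii `rho1 (lev k) …` for contours of length `ℓ_k ≤ (d+1)·lev k` (p3's
`holoRadiusCompat_rhoStar`, re-exported at the tower letters through `HoloRadiusCompat.trans`). -/
theorem holoRadiusCompat_rhoLev_rho1 (ha' : 0 ≤ a') (hγ : 0 < γ) (ℓ : Fin (P.K + 1) → ℕ)
    (hℓ : ∀ k, (ℓ k : ℝ) ≤ ((P.d : ℝ) + 1) * (lev P.L k : ℕ)) :
    HoloRadiusCompat (fun _ : Fin (P.K + 1) => rhoLev P (o := o) γ a') (fun k => rho1 (lev P.L k) P.d a' (Fintype.card o) (ℓ k) γ) :=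
  (holoRadiusCompat_rhoLev P ha' hγ).trans (holoRadiusCompat_rhoStar P ha' hγ (Fintype.card o) ℓ hℓ)

/-! ## §2 The Lev trio on the explicit ball -/

variable {R₀ : TowerData P o} (hR₀ : ∀ (k : Fin (P.K + 1)) ν i, R₀ k ν i ∈ Matrix.unitaryGroup o ℂ) (ha' : 0 ≤ a')
  (hco : ∀ k : Fin (P.K + 1), Coercive γ (vecOp (lev P.L k) (unitMod P) a' (Γ k) (R₀ k))) (hγ : 0 < γ)
  {ℓ : Fin (P.K + 1) → ℕ} (hΓ : ∀ (k : Fin (P.K + 1)) y j μ (t : Fin (lev P.L k)), (Γ k y j μ t).length ≤ ℓ k)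
  (hℓ : ∀ k : Fin (P.K + 1), (ℓ k : ℝ) ≤ ((P.d : ℝ) + 1) * (lev P.L k : ℕ))

include hR₀ ha' hco hγ hΓ hℓ in
/-- [folklore] **INSIDE `rhoLev` EVERY LEVEL IS REGULAR WITH `‖greenT_k‖ ≤ 4/γ`** — p3's `inHoloBallT_rhoStar_subset_regularSetAt` BY NAME at level
`k`, through `rhoLev ≤ rhoStar/lev k`. -/
theorem mem_regularSetAt_of_norm_lt_rhoLev {A : TowerData P o} (hA : ‖A‖ < rhoLev P (o := o) γ a') (k : Fin (P.K + 1)) :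
    A ∈ regularSetAt P (cPr P k) (aPr P a' k) Γ R₀ k ∧
      ‖greenT (lev P.L k) (unitMod P) (cPr P k) (aPr P a' k) (Γ k) (expChartT P R₀ A k) (expChartInvT P R₀ A k)‖ ≤ 4 / γ :=
  inHoloBallT_rhoStar_subset_regularSetAt P Γ k (hΓ k) (hℓ k) (hR₀ k) ha' (hco k) hγ
    ((inHoloBallT_iff P R₀ _ A).2 (mem_ball_zero_iff.2 (lt_of_lt_of_le hA (rhoLev_le_div P ha' hγ k))))

include hR₀ ha' hco hγ hΓ hℓ in
/-- [folklore] **THE EXPLICIT BALL LIES IN THE LEVEL-LETTERED REGULAR SET AT THE PRINTED LETTERS.** -/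
theorem ball_rhoLev_subset_regularSetLev :
    Metric.ball (0 : TowerData P o) (rhoLev P (o := o) γ a') ⊆ regularSetLev P (cPr P) (aPr P a') Γ R₀ := fun _ hA =>
  (mem_regularSetLev_iff P _ _ Γ R₀ _).2 fun k => (mem_regularSetAt_of_norm_lt_rhoLev P Γ hR₀ ha' hco hγ hΓ hℓ (mem_ball_zero_iff.1 hA) k).1

include hR₀ ha' hco hγ hΓ hℓ in
/-- [folklore] **`‖greenT_k‖ ≤ 4/γ` AT EVERY LEVEL ON THE EXPLICIT BALL** — the Cauchy input with an explicit radius. -/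
theorem opNorm_greenT_le_on_ballExplicit {A : TowerData P o} (hA : A ∈ Metric.ball (0 : TowerData P o) (rhoLev P (o := o) γ a'))
    (k : Fin (P.K + 1)) :
    ‖greenT (lev P.L k) (unitMod P) (cPr P k) (aPr P a' k) (Γ k) (expChartT P R₀ A k) (expChartInvT P R₀ A k)‖ ≤ 4 / γ :=
  (mem_regularSetAt_of_norm_lt_rhoLev P Γ hR₀ ha' hco hγ hΓ hℓ (mem_ball_zero_iff.1 hA) k).2

include hR₀ ha' hco hγ hΓ hℓ in
/-- [folklore] The centre of the chart is regular at every level at the printed letters (explicit road). -/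
theorem zero_mem_regularSetLev_printed_explicit : (0 : TowerData P o) ∈ regularSetLev P (cPr P) (aPr P a') Γ R₀ :=
  ball_rhoLev_subset_regularSetLev P Γ hR₀ ha' hco hγ hΓ hℓ (Metric.mem_ball_self (rhoLev_pos P ha' hγ))

variable (s : ℕ → ℂ)

include hR₀ ha' hco hγ hΓ hℓ in
/-- [folklore] **AT THE PRINTED LETTERS EVERY ENTRY OF `covAtTLev` ALONG THE CHART IS ANALYTIC ON THE EXPLICIT BALL `ball 0 rhoLev`**, every level —
`analyticOnNhd_covAtTLev_expChart` (p223342 ∕ p221513) restricted by `ball_rhoLev_subset_regularSetLev`. -/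
theorem analyticOnNhd_covAtTLev_printed_on_ballExplicit (k : ℕ) {T : Type*} (t : T) (b b' : (Tor (unitMod P) × Fin P.d) × o) :
    AnalyticOnNhd ℂ (fun A : TowerData P o => covAtTLev P (cPr P) (aPr P a') Γ s (expChartT P R₀ A) (expChartInvT P R₀ A) k t b b')
      (Metric.ball (0 : TowerData P o) (rhoLev P (o := o) γ a')) :=
  (analyticOnNhd_covAtTLev_expChart P (cPr P) (aPr P a') Γ s R₀ k t b b').mono (ball_rhoLev_subset_regularSetLev P Γ hR₀ ha' hco hγ hΓ hℓ)

include hR₀ ha' hco hγ hΓ hℓ in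
/-- [folklore] The `∃ ρ > 0` shape, WITNESSED by the explicit `rhoLev`. -/
theorem exists_ball_analyticOnNhd_covAtTLev_printed_explicit :
    ∃ ρ > 0, ∀ (k : ℕ) {T : Type*} (t : T) (b b' : (Tor (unitMod P) × Fin P.d) × o),
      AnalyticOnNhd ℂ (fun A : TowerData P o => covAtTLev P (cPr P) (aPr P a') Γ s (expChartT P R₀ A) (expChartInvT P R₀ A) k t b b')
        (Metric.ball (0 : TowerData P o) ρ) :=
  ⟨_, rhoLev_pos P ha' hγ, fun k _ t b b' => analyticOnNhd_covAtTLev_printed_on_ballExplicit P Γ hR₀ ha' hco hγ hΓ hℓ s k t b b'⟩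

/-! ## §3 The standard contour system meets the length hypothesis -/

/-- [folklore] The STANDARD tower contour system: at level `k`, `CovariantBlockAveraging.contour (lev P.L k) (unitMod P)`. -/
def stdContours (P : Params) : (k : ℕ) → ContourSystem P.d (lev P.L k) (unitMod P) := fun k => contour (lev P.L k) (unitMod P)

/-- [folklore] The standard length letter `(d+1)·lev k`. -/
def stdLen (P : Params) (k : Fin (P.K + 1)) : ℕ := (P.d + 1) * lev P.L k

omit [Fintype o] [DecidableEq o] [Nonempty o] in
/-- [folklore] The standard contours have length `≤ (d+1)·lev k` (`length_contour_le`). -/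
theorem length_stdContours_le (k : Fin (P.K + 1)) (y : Tor (unitMod P)) (j : Fin P.d → Fin (lev P.L k)) (μ : Fin P.d)
    (t : Fin (lev P.L k)) : (stdContours P k y j μ t).length ≤ stdLen P k :=
  length_contour_le (lev P.L k) (unitMod P) y j μ t.is_lt

omit [Fintype o] [DecidableEq o] [Nonempty o] in
/-- [folklore] … and `stdLen k ≤ (d+1)·lev k` as reals (equality). -/
theorem stdLen_le (k : Fin (P.K + 1)) : (stdLen P k : ℝ) ≤ ((P.d : ℝ) + 1) * (lev P.L k : ℕ) := by
  simp only [stdLen, Nat.cast_mul, Nat.cast_add, Nat.cast_one, le_refl]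

variable {P} in
/-- [folklore] **THE EXPLICIT BALL FOR THE STANDARD CONTOURS — NO LENGTH BINDER.** -/
theorem ball_rhoLev_subset_regularSetLev_std (hR₀ : ∀ (k : Fin (P.K + 1)) ν i, R₀ k ν i ∈ Matrix.unitaryGroup o ℂ) (ha' : 0 ≤ a')
    (hco : ∀ k : Fin (P.K + 1), Coercive γ (vecOp (lev P.L k) (unitMod P) a' (stdContours P k) (R₀ k))) (hγ : 0 < γ) :
    Metric.ball (0 : TowerData P o) (rhoLev P (o := o) γ a') ⊆ regularSetLev P (cPr P) (aPr P a') (stdContours P) R₀ :=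
  ball_rhoLev_subset_regularSetLev P (stdContours P) hR₀ ha' hco hγ (length_stdContours_le P) (stdLen_le P)

variable {P} in
/-- [folklore] Analyticity of `covAtTLev` on the explicit ball, standard contours, no length binder. -/
theorem analyticOnNhd_covAtTLev_printed_on_ballExplicit_std (hR₀ : ∀ (k : Fin (P.K + 1)) ν i, R₀ k ν i ∈ Matrix.unitaryGroup o ℂ)
    (ha' : 0 ≤ a') (hco : ∀ k : Fin (P.K + 1), Coercive γ (vecOp (lev P.L k) (unitMod P) a' (stdContours P k) (R₀ k))) (hγ : 0 < γ)
    (k : ℕ) {T : Type*} (t : T) (b b' : (Tor (unitMod P) × Fin P.d) × o) :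
    AnalyticOnNhd ℂ (fun A : TowerData P o =>
        covAtTLev P (cPr P) (aPr P a') (stdContours P) s (expChartT P R₀ A) (expChartInvT P R₀ A) k t b b')
      (Metric.ball (0 : TowerData P o) (rhoLev P (o := o) γ a')) :=
  analyticOnNhd_covAtTLev_printed_on_ballExplicit P (stdContours P) hR₀ ha' hco hγ (length_stdContours_le P) (stdLen_le P) s k t b b'

/-! ## §4 The tower OF RECORD: a BACKGROUND-FREE explicit radius -/

section Record

variable {G : Type*} [GaugeGroup G] (ι : G →* Matrix o o ℂ) (av : ∀ j, Averaging P j G) {α τ : ℝ}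
variable (hι : ∀ g, ι g ∈ Matrix.unitaryGroup o ℂ) (hdist : ∀ g : G, ‖ι g - 1‖ = dist1 g) (U : GaugeField P 0 G) (ha'0 : 0 < a')
  (hα : 0 ≤ α) (hτ : 0 ≤ τ)
  (hU : ∀ (k : Fin (P.K + 1)) (b : PBond P (P.K - k)), ((lev P.L k : ℕ) : ℝ) * dist1 (Averaging.iter av (P.K - k) U b) ≤ α)
  (hT : ∀ (k : Fin (P.K + 1)) y jj μ (t : Fin (lev P.L k)),
    ‖transport (fine (lev P.L k) (unitMod P)) (towerDataOf P ι av U k) μ (Γ k y jj μ t) - 1‖ ≤ τ)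
  (hγV : 0 < gammaV (Fintype.card o) P.d a' α τ)

include hι hdist ha'0 hα hτ hU hT hγV hΓ hℓ in
/-- [folklore] **THE EXPLICIT BALL AT THE RECORD**: for the chart centred at the tower data of record of a levelwise-regular `U` (unitary `ι` with
`‖ι g − 1‖ = dist1 g`, small-field letters `α`, `τ` at every level, `0 < a′`, `0 < gammaV`, contour lengths `ℓ_k ≤ (d+1)·lev k`) the ball of the
BACKGROUND-FREE radius `rhoLev P (gammaV (card o) d a′ α τ) a′` lies in the level-lettered regular set (J-3a's `hco` BY NAME through
`coercive_vecOp_towerDataOf_of_regular`). -/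
theorem ball_rhoLev_subset_regularSetLev_towerDataOf :
    Metric.ball (0 : TowerData P o) (rhoLev P (o := o) (gammaV (Fintype.card o) P.d a' α τ) a')
      ⊆ regularSetLev P (cPr P) (aPr P a') Γ (towerDataOf P ι av U) :=
  ball_rhoLev_subset_regularSetLev P Γ (fun k ν i => transV_mem_unitaryGroup _ hι (Averaging.iter av (P.K - k) U) ν i) ha'0.le
    (coercive_vecOp_towerDataOf_of_regular P Γ ι av hdist U ha'0 hα hτ hU hT) hγV hΓ hℓ

include hι hdist ha'0 hα hτ hU hT hγV hΓ hℓ in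
/-- [folklore] `‖greenT_k‖ ≤ 4/gammaV` at every level on the explicit ball at the record. -/
theorem opNorm_greenT_le_on_ballExplicit_towerDataOf {A : TowerData P o}
    (hA : A ∈ Metric.ball (0 : TowerData P o) (rhoLev P (o := o) (gammaV (Fintype.card o) P.d a' α τ) a')) (k : Fin (P.K + 1)) :
    ‖greenT (lev P.L k) (unitMod P) (cPr P k) (aPr P a' k) (Γ k) (expChartT P (towerDataOf P ι av U) A k)
        (expChartInvT P (towerDataOf P ι av U) A k)‖ ≤ 4 / gammaV (Fintype.card o) P.d a' α τ :=
  opNorm_greenT_le_on_ballExplicit P Γ (fun k ν i => transV_mem_unitaryGroup _ hι (Averaging.iter av (P.K - k) U) ν i) ha'0.le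
    (coercive_vecOp_towerDataOf_of_regular P Γ ι av hdist U ha'0 hα hτ hU hT) hγV hΓ hℓ hA k

include hι hdist ha'0 hα hτ hU hT hγV hΓ hℓ in
/-- [folklore] **THE QUANTITATIVE ANALYTIC BALL AT THE RECORD, EXPLICIT RADIUS**: at the printed letters every entry of `covAtTLev` along the chart
centred at `towerDataOf P ι av U` is analytic on `ball 0 (rhoLev P (gammaV …) a′)` at every level. -/
theorem analyticOnNhd_covAtTLev_printed_towerDataOf_explicit (k : ℕ) {T : Type*} (t : T) (b b' : (Tor (unitMod P) × Fin P.d) × o) :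
    AnalyticOnNhd ℂ (fun A : TowerData P o => covAtTLev P (cPr P) (aPr P a') Γ s (expChartT P (towerDataOf P ι av U) A)
        (expChartInvT P (towerDataOf P ι av U) A) k t b b')
      (Metric.ball (0 : TowerData P o) (rhoLev P (o := o) (gammaV (Fintype.card o) P.d a' α τ) a')) :=
  analyticOnNhd_covAtTLev_printed_on_ballExplicit P Γ (fun k ν i => transV_mem_unitaryGroup _ hι (Averaging.iter av (P.K - k) U) ν i)
    ha'0.le (coercive_vecOp_towerDataOf_of_regular P Γ ι av hdist U ha'0 hα hτ hU hT) hγV hΓ hℓ s k t b b'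

end Record

/-! ## §5 (v1.1) Per-level CYLINDERS: level `k` reads only `A k`, so the level-`k` radius is `rhoStar ∕ lev k` — LEVEL-UNIFORM constants
(located remark R-ne9leaf08g15-1, ne9-leaf-08-g15 l.16592: a Cauchy estimate read at the ONE tower radius `rhoLev = rhoStar∕L^K` carries `L^K∕rhoStar`
at every level; the per-level radii `rhoStar∕lev k` give the level-uniform count in Bałaban's scaled variable — this section is that slot BY NAME) -/

section LevelBall

open Summit.QuantumFields.BalabanUV.T4Continuum.SubstrateTransporterSpeciesAnalytic (analyticAt_matrix_iff analyticOnNhd_unitCovT_expChartT)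

/-- [folklore] The level-`k` CYLINDER of radius `ρ`: towers whose level-`k` coordinate has norm `< ρ` (no condition at the other levels). -/
def levelBall (k : Fin (P.K + 1)) (ρ : ℝ) : Set (TowerData P o) := {A | ‖A k‖ < ρ}

omit [Nonempty o] in
/-- [folklore] Membership, unfolded. -/
theorem mem_levelBall_iff (k : Fin (P.K + 1)) (ρ : ℝ) (A : TowerData P o) : A ∈ levelBall P k ρ ↔ ‖A k‖ < ρ := Iff.rfl

omit [Nonempty o] in
/-- [folklore] The cylinder is OPEN (continuity of the level-`k` projection and of the norm). -/
theorem isOpen_levelBall (k : Fin (P.K + 1)) (ρ : ℝ) : IsOpen (levelBall P (o := o) k ρ) :=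
  isOpen_lt ((continuous_apply k).norm) continuous_const

omit [Nonempty o] in
/-- [folklore] The tower ball of radius `ρ` lies in every level cylinder of radius `ρ` (`‖A k‖ ≤ ‖A‖`). -/
theorem ball_subset_levelBall (k : Fin (P.K + 1)) (ρ : ℝ) : Metric.ball (0 : TowerData P o) ρ ⊆ levelBall P k ρ := fun A hA =>
  lt_of_le_of_lt (norm_le_pi_norm A k) (mem_ball_zero_iff.1 hA)

omit [Nonempty o] in
/-- [folklore] … in particular the `rhoLev`-ball lies in the level-`k` cylinder of radius `rhoStar∕lev k` (`rhoLev_le_div`). -/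
theorem ball_rhoLev_subset_levelBall (ha' : 0 ≤ a') (hγ : 0 < γ) (k : Fin (P.K + 1)) :
    Metric.ball (0 : TowerData P o) (rhoLev P (o := o) γ a')
      ⊆ levelBall P k (CovariantVectorCoerciveHoloForm.rhoStar γ P.d a' (Fintype.card o) / (lev P.L k : ℕ)) := fun _ hA =>
  lt_of_lt_of_le (ball_subset_levelBall P k _ hA) (rhoLev_le_div P ha' hγ k)

include hR₀ ha' hco hγ hΓ hℓ in
/-- [folklore] **INSIDE THE LEVEL-`k` CYLINDER OF RADIUS `rhoStar∕lev k` THE LEVEL-`k` OPERATOR IS REGULAR WITH `‖greenT_k‖ ≤ 4∕γ`** — p3's one-level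
`isUnit_det_deltaQT_of_norm_lt_rho1` ∕ `opNorm_greenT_le_of_norm_lt_rho1` BY NAME at the level-`k` coordinate, through `rhoStar_div_le_rho1`; no condition on
the other levels (the level-uniform slot of R-ne9leaf08g15-1). -/
theorem mem_regularSetAt_of_mem_levelBall (k : Fin (P.K + 1)) {A : TowerData P o}
    (hA : A ∈ levelBall P k (CovariantVectorCoerciveHoloForm.rhoStar γ P.d a' (Fintype.card o) / (lev P.L k : ℕ))) :
    A ∈ regularSetAt P (cPr P k) (aPr P a' k) Γ R₀ k ∧
      ‖greenT (lev P.L k) (unitMod P) (cPr P k) (aPr P a' k) (Γ k) (expChartT P R₀ A k) (expChartInvT P R₀ A k)‖ ≤ 4 / γ := by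
  have hn : 1 ≤ (lev P.L k : ℕ) := Nat.one_le_iff_ne_zero.mpr (NeZero.ne _)
  have hAk : ‖A k‖ < rho1 (lev P.L k) P.d a' (Fintype.card o) (ℓ k) γ :=
    lt_of_lt_of_le hA (CovariantVectorCoerciveHoloForm.rhoStar_div_le_rho1 (lev P.L k) (d := P.d) ha' hγ (Fintype.card o) hn (hℓ k))
  exact ⟨CovariantVectorCoerciveHoloForm.isUnit_det_deltaQT_of_norm_lt_rho1 (lev P.L k) (unitMod P) (hR₀ k) (Γ k) (hΓ k) ha' (hco k) hγ hAk,
    CovariantVectorCoerciveHoloForm.opNorm_greenT_le_of_norm_lt_rho1 (lev P.L k) (unitMod P) (hR₀ k) (Γ k) (hΓ k) ha' (hco k) hγ hAk⟩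

include hR₀ ha' hco hγ hΓ hℓ in
/-- [folklore] **THE LEVEL-`k` ENTRIES OF `covAtTLev` ALONG THE CHART ARE ANALYTIC ON THE WHOLE LEVEL-`k` CYLINDER OF RADIUS `rhoStar∕lev k`** (printed
letters; `covAtTLev … k` reads only the level-`k` coordinates — p221513's `analyticOnNhd_unitCovT_expChartT` at level `k` BY NAME): the per-level analytic
domain whose radius carries ONE inverse power of `lev k`, not of `L^K`. -/
theorem analyticOnNhd_covAtTLev_printed_on_levelBall (k : Fin (P.K + 1)) {T : Type*} (t : T) (b b' : (Tor (unitMod P) × Fin P.d) × o) :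
    AnalyticOnNhd ℂ (fun A : TowerData P o => covAtTLev P (cPr P) (aPr P a') Γ s (expChartT P R₀ A) (expChartInvT P R₀ A) k t b b')
      (levelBall P k (CovariantVectorCoerciveHoloForm.rhoStar γ P.d a' (Fintype.card o) / (lev P.L k : ℕ))) := by
  intro A₀ hA₀
  have hk : (k : ℕ) ≤ P.K := Nat.le_of_lt_succ k.2
  have hreg := (mem_regularSetAt_of_mem_levelBall P Γ hR₀ ha' hco hγ hΓ hℓ k hA₀).1
  unfold covAtTLev covAtT
  simp only [dif_pos hk, Fin.eta]
  exact analyticAt_matrix_iff.1 (analyticOnNhd_unitCovT_expChartT P (cPr P k) (aPr P a' k) Γ R₀ k (s k) A₀ hreg) b b'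

end LevelBall

end Summit.QuantumFields.BalabanUV.T4Continuum.SubstrateTransporterSpeciesLevExplicit

end
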